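import Summits.HodgeConjecture.CorCM.GaloisOddPrimeShapesQuaternionBottom
import Summits.HodgeConjecture.CorCM.GaloisQuaternionOneTwentyEightCyclicSeventyOneWord
import HarnessLib

/-!
# `p = 71`: shapes Q×/QK are BAD (bottom `Q₁₂₈ × C_{71}`), GOOD Galois CM fields of degree `2ⁿ·71` (`n ≥ 8`) have shape C(r) or Dic and
# satisfy the Hodge conjecture for all powers of all their CM abelian varieties; `Gal ≅ Q_{128k} × C_{71}` is BAD

COR-CM (cell `pub-hodgecm2`), binder seat b04 (gen 41), count-neutral own lane «Galois-CM-type classification».  KERNEL ONLY: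
theorems; no definition, no named fact, no `sorry`.  `HC_CM` is neither used nor claimed.

The `p = 71` column of the classification of Galois CM fields of degree `2ⁿ·p` (gens 38–41), obtained from the parametric column
`CorCM/GaloisOddPrimeShapesQuaternionBottom` (`t = 5`) and gen 41's two-sheet norm certificate (REFLECTION ANSATZ, word format)
`exists_simple_degenerate_of_quaternionOneTwentyEight_cyclic71_subgroup` (`CorCM/GaloisQuaternionOneTwentyEightCyclicSeventyOneWord`): `Q₁₂₈ × C_{71} ↪ Gal through c with
C_{71} normal ⟹ BAD` (a `p` beyond every earlier bottom: `(71+3)/2 > 24` letters need `m = 32`).  Arithmetic: `71 − 1 = 70 = 2·35`,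
`71 + 1 = 72 = 2³·9`, so every shape C(r) has `ord r ∣ 2` (`j = 1`) and gen 38's residue conditions `4 ∤ 71 − 1`, `2ⁿ⁻¹ ∤ 71 + 1` hold for
`n ≥ 5`; the parametric column needs `n ≥ t + 3 = 8`.

* `bottom_certificate_seventyone`, `exists_simple_degenerate_of_shape_quaternion_seventyone` (Q× for `n ≥ 7`, QK for `n ≥ 8`),
  `structure_of_forall_isNondegenerate_of_thirtytwo_dvd_seventyone` (`n ≥ 8`), **`hodgeConjectureFor_pow_of_forall_isNondegenerate_seventyone`** (`n ≥ 8`),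
  `hodge_dichotomy_seventyone`, `exists_simple_degenerate_of_mulEquiv_quaternion_prod_cyclic_seventyone` (`Gal ≅ Q_{128k} × C_{71}`, `k ≥ 1`).

OPEN at `p = 71`: `5 ≤ n ≤ 7` (no reflection-ansatz Gauss word on `Q₁₆`, `Q₃₂`, `Q₆₄ × C_{71}`: `(71+1)/2 > 3m/2`, gen 41 census) and `n ≤ 4`.

## References

* [Shimura1998] G. Shimura, *Abelian Varieties with Complex Multiplication and Modular Functions*, §6.2 Thm. 3, §8.2 Prop. 26, §32.10.
* [Gordon1999HodgeAVSurvey] B. B. Gordon, *A survey of the Hodge conjecture for abelian varieties*, Thm. 6.4, §9.3.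
* [Pohlmann1968] H. Pohlmann, *Algebraic cycles on abelian varieties of complex multiplication type*, Ann. of Math. 88 (1968), Thm. 1.
* [Dodson1984] B. Dodson, *The structure of Galois groups of CM-fields*, Trans. AMS 283 (1984), §3.1.1, §4.1, §5.
-/

noncomputable section

open CategoryTheory CategoryTheory.Limits NumberField
open scoped BigOperators

namespace Summit.HodgeConjecture.CorCM.GaloisModels

open Literature.NumberTheory.ComplexMultiplication Literature.AlgebraicGeometry.HodgeTheory
open Literature.AlgebraicGeometry.Motives (AbelianVariety CMType)
open Literature.AlgebraicGeometry.ComplexMultiplication (IsCMTypeRealisation)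
open Literature.AlgebraicGeometry.Pohlmann1968 Summit.HodgeConjecture.CorCM.GaloisRank
open Literature.Barriers.HodgeConjecture (divisorClassesSpan)
open QuaternionGroup

variable {K : Type} [Field K] [NumberField K] [IsCMField K]

/-- **The bottom certificate `Q₁₂₈ × C_{71} ↪ Gal(K/ℚ)` through `c` with `C_{71}` normal ⟹ BAD**, in the parametric form (`t = 5`).
[cite: Shimura1998, §6.2 Thm. 3 and §8.2 Prop. 26] [cite: Gordon1999HodgeAVSurvey, Thm. 6.4 and §9.3] -/
theorem bottom_certificate_seventyone [IsGalois ℚ K] :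
    ∀ A X v : K ≃ₐ[ℚ] K, orderOf A = 2 ^ (5 + 1) → X * X = A ^ 2 ^ 5 → X * A * X⁻¹ = A⁻¹ →
      A ^ 2 ^ 5 = (IsCMField.complexConj K).restrictScalars ℚ → orderOf v = 71 → A * v = v * A → X * v = v * X →
      (Subgroup.zpowers v).Normal →
      ∃ (Φ : CMType K) (φ₀ : K →+* ℂ) (A : AbelianVariety ℂ) (ι : 𝓞 K →+* End A)
        (θ : K →+* Module.End ℂ (complexBetti A.X 1)),
        IsPrimitive (ℂ ≃+* ℂ) Φ.1 φ₀ ∧ ¬ IsNondegenerate Φ ∧ IsCMTypeRealisation Φ A ι θ ∧ A.IsSimple ∧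
        A.dim = Module.finrank ℚ K / 2 ∧
        ∃ n p : ℕ, ∃ x : complexBetti (⨁ fun _ : Fin n => A).X (2 * p), IsRationalClass x ∧
          IsOfHodgeType (⨁ fun _ : Fin n => A).dim (⨁ fun _ : Fin n => A).X (2 * p) p p x ∧
          x ∉ divisorClassesSpan (⨁ fun _ : Fin n => A).X (⨁ fun _ : Fin n => A).dim p := by
  intro A X v hA hX hXA hc hv hAv hXv hnorm
  norm_num at hA hX hc
  exact exists_simple_degenerate_of_quaternionOneTwentyEight_cyclic71_subgroup hA hX hXA hc hv hAv hXv hnorm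

/-- **SHAPES Q× (`n ≥ 7`) AND QK (`n ≥ 8`) ARE BAD FOR `p = 71`** (subgroup `⟨a^{2ⁿ⁻⁷}, x⟩ × ⟨u⟩ ≅ Q₁₂₈ × C_{71}` through `c`).
[cite: Shimura1998, §6.2 Thm. 3 and §8.2 Prop. 26] [cite: Gordon1999HodgeAVSurvey, Thm. 6.4 and §9.3] -/
theorem exists_simple_degenerate_of_shape_quaternion_seventyone [IsGalois ℚ K] {n : ℕ} (hn : 7 ≤ n) {u a x : K ≃ₐ[ℚ] K}
    (hu : orderOf u = 71) (hnorm : (Subgroup.zpowers u).Normal) (ha : orderOf a = 2 ^ (n - 1)) (hxa : x * a = a⁻¹ * x)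
    (hxx : x * x = a ^ 2 ^ (n - 2)) (hc : a ^ 2 ^ (n - 2) = (IsCMField.complexConj K).restrictScalars ℚ)
    (hxu : x * u * x⁻¹ = u) (hau : a * u * a⁻¹ = u ∨ (a * u * a⁻¹ = u⁻¹ ∧ 8 ≤ n)) :
    ∃ (Φ : CMType K) (φ₀ : K →+* ℂ) (A : AbelianVariety ℂ) (ι : 𝓞 K →+* End A)
      (θ : K →+* Module.End ℂ (complexBetti A.X 1)),
      IsPrimitive (ℂ ≃+* ℂ) Φ.1 φ₀ ∧ ¬ IsNondegenerate Φ ∧ IsCMTypeRealisation Φ A ι θ ∧ A.IsSimple ∧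
      A.dim = Module.finrank ℚ K / 2 ∧
      ∃ n p : ℕ, ∃ x : complexBetti (⨁ fun _ : Fin n => A).X (2 * p), IsRationalClass x ∧
        IsOfHodgeType (⨁ fun _ : Fin n => A).dim (⨁ fun _ : Fin n => A).X (2 * p) p p x ∧
        x ∉ divisorClassesSpan (⨁ fun _ : Fin n => A).X (⨁ fun _ : Fin n => A).dim p :=
  exists_simple_degenerate_of_shape_quaternion_of_bottom bottom_certificate_seventyone (by omega) hu hnorm ha hxa hxx hc hxu
    (hau.imp_right fun h => ⟨h.1, by omega⟩)

/-- **GOOD Galois CM fields of degree `2ⁿ·71`, `n ≥ 8`: shape C(r) or Dic.** [cite: Shimura1998, §8.2 Prop. 26 and §32.10]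
[cite: Dodson1984, §3.1.1, §4.1 and §5] -/
theorem structure_of_forall_isNondegenerate_of_thirtytwo_dvd_seventyone [IsGalois ℚ K] {n : ℕ}
    (hdeg : Module.finrank ℚ K = 2 ^ n * 71) (hn : 8 ≤ n)
    (hgood : ∀ (Φ : CMType K) (φ : K →+* ℂ), IsPrimitive (ℂ ≃+* ℂ) Φ.1 φ → IsNondegenerate Φ) [Fact (Nat.Prime 2)] :
    (∀ σ : K ≃ₐ[ℚ] K, σ * σ = 1 → σ ≠ 1 → σ = (IsCMField.complexConj K).restrictScalars ℚ) ∧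
      ∀ S : Sylow 2 (K ≃ₐ[ℚ] K), Nat.card (S : Subgroup (K ≃ₐ[ℚ] K)) = 2 ^ n ∧
        ((∃ u x : K ≃ₐ[ℚ] K, orderOf u = 71 ∧ (Subgroup.zpowers u).Normal ∧ orderOf x = 2 ^ n ∧
            Subgroup.zpowers x = (S : Subgroup (K ≃ₐ[ℚ] K)) ∧ (∀ g : K ≃ₐ[ℚ] K, ∃ j i : ℕ, g = u ^ j * x ^ i) ∧
            ∃ r : ℕ, x * u * x⁻¹ = u ^ r) ∨
         (∃ u a x : K ≃ₐ[ℚ] K, orderOf u = 71 ∧ (Subgroup.zpowers u).Normal ∧ orderOf a = 2 ^ (n - 1) ∧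
            a ∈ (S : Subgroup (K ≃ₐ[ℚ] K)) ∧ x ∈ (S : Subgroup (K ≃ₐ[ℚ] K)) ∧ x ∉ Subgroup.zpowers a ∧ x * a = a⁻¹ * x ∧
            x * x = a ^ 2 ^ (n - 2) ∧ (∀ g : K ≃ₐ[ℚ] K, ∃ j i : ℕ, g = u ^ j * a ^ i ∨ g = u ^ j * (x * a ^ i)) ∧
            a * u * a⁻¹ = u ∧ x * u * x⁻¹ = u⁻¹)) :=
  structure_of_forall_isNondegenerate_of_thirtytwo_dvd_of_bottom (t := 5) (by norm_num) (by norm_num) hdeg (by omega) (by omega)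
    bottom_certificate_seventyone hgood

variable {Φ : CMType K} {A : AbelianVariety ℂ} {ι : 𝓞 K →+* End A} {θ : K →+* Module.End ℂ (complexBetti A.X 1)}

/-- **A GOOD Galois CM field of degree `2ⁿ·71`, `n ≥ 8`, satisfies the Hodge conjecture for all powers of every abelian variety with CM by
`K`** (`j = 1`: `4 ∤ 70`, `2ⁿ⁻¹ ∤ 72`). [cite: Pohlmann1968, Thm. 1] [cite: Shimura1998, §8.2 Prop. 26 and §32.10]
[cite: Gordon1999HodgeAVSurvey, Thm. 6.4 and §9.3] -/
theorem hodgeConjectureFor_pow_of_forall_isNondegenerate_seventyone [IsGalois ℚ K] {n : ℕ}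
    (hdeg : Module.finrank ℚ K = 2 ^ n * 71) (hn : 8 ≤ n)
    (hgood : ∀ (Ψ : CMType K) (φ : K →+* ℂ), IsPrimitive (ℂ ≃+* ℂ) Ψ.1 φ → IsNondegenerate Ψ)
    (hA : IsCMTypeRealisation Φ A ι θ) (N : ℕ) :
    HodgeConjectureFor (⨁ fun _ : Fin N => A).dim (⨁ fun _ : Fin N => A).X :=
  hodgeConjectureFor_pow_of_forall_isNondegenerate_of_bottom (t := 5) (j := 1) (by norm_num) (by norm_num) hdeg (by omega)
    (by omega) bottom_certificate_seventyone le_rfl (by omega) (by decide) (not_two_pow_dvd_of_le (e := 4) (by omega) (by decide))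
    hgood hA N

/-- **The Hodge dichotomy for Galois CM fields of degree `2ⁿ·71`, `n ≥ 8`.** [cite: Pohlmann1968, Thm. 1]
[cite: Shimura1998, §6.2 Thm. 3, §8.2 Prop. 26 and §32.10] [cite: Gordon1999HodgeAVSurvey, Thm. 6.4 and §9.3] -/
theorem hodge_dichotomy_seventyone [IsGalois ℚ K] {n : ℕ} (hdeg : Module.finrank ℚ K = 2 ^ n * 71) (hn : 8 ≤ n) :
    (∀ (Φ : CMType K) (A : AbelianVariety ℂ) (ι : 𝓞 K →+* End A) (θ : K →+* Module.End ℂ (complexBetti A.X 1)),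
        IsCMTypeRealisation Φ A ι θ → ∀ N : ℕ, HodgeConjectureFor (⨁ fun _ : Fin N => A).dim (⨁ fun _ : Fin N => A).X) ∨
      ∃ (Φ : CMType K) (φ : K →+* ℂ) (X : AbelianVariety ℂ) (ι : 𝓞 K →+* End X)
        (ϑ : K →+* Module.End ℂ (complexBetti X.X 1)),
        IsPrimitive (ℂ ≃+* ℂ) Φ.1 φ ∧ ¬ IsNondegenerate Φ ∧ IsCMTypeRealisation Φ X ι ϑ ∧ X.IsSimple ∧
        X.dim = Module.finrank ℚ K / 2 ∧
        ∃ n p : ℕ, ∃ x : complexBetti (⨁ fun _ : Fin n => X).X (2 * p), IsRationalClass x ∧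
          IsOfHodgeType (⨁ fun _ : Fin n => X).dim (⨁ fun _ : Fin n => X).X (2 * p) p p x ∧
          x ∉ divisorClassesSpan (⨁ fun _ : Fin n => X).X (⨁ fun _ : Fin n => X).dim p :=
  hodge_dichotomy_of_bottom (t := 5) (j := 1) (by norm_num) (by norm_num) hdeg (by omega) (by omega) bottom_certificate_seventyone
    le_rfl (by omega) (by decide) (not_two_pow_dvd_of_le (e := 4) (by omega) (by decide))

/-- **`Gal(K/ℚ) ≅ Q_{128k} × C_{71}` IS BAD** for every `k ≥ 1` (`Q_{128k} = QuaternionGroup (32k)`).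
[cite: Shimura1998, §6.2 Thm. 3 and §8.2 Prop. 26] [cite: Gordon1999HodgeAVSurvey, Thm. 6.4 and §9.3] -/
theorem exists_simple_degenerate_of_mulEquiv_quaternion_prod_cyclic_seventyone [IsGalois ℚ K] {k : ℕ} [NeZero k]
    (e : (K ≃ₐ[ℚ] K) ≃* QuaternionGroup (32 * k) × Multiplicative (ZMod 71)) :
    ∃ (Φ : CMType K) (φ₀ : K →+* ℂ) (A : AbelianVariety ℂ) (ι : 𝓞 K →+* End A)
      (θ : K →+* Module.End ℂ (complexBetti A.X 1)),
      IsPrimitive (ℂ ≃+* ℂ) Φ.1 φ₀ ∧ ¬ IsNondegenerate Φ ∧ IsCMTypeRealisation Φ A ι θ ∧ A.IsSimple ∧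
      A.dim = Module.finrank ℚ K / 2 ∧
      ∃ n p : ℕ, ∃ x : complexBetti (⨁ fun _ : Fin n => A).X (2 * p), IsRationalClass x ∧
        IsOfHodgeType (⨁ fun _ : Fin n => A).dim (⨁ fun _ : Fin n => A).X (2 * p) p p x ∧
        x ∉ divisorClassesSpan (⨁ fun _ : Fin n => A).X (⨁ fun _ : Fin n => A).dim p :=
  exists_simple_degenerate_of_mulEquiv_quaternion_prod_cyclic_of_bottom (t := 5) (by decide) bottom_certificate_seventyone
    (by rwa [show (2 : ℕ) ^ 5 = 32 by norm_num])

end Summit.HodgeConjecture.CorCM.GaloisModels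

end
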